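import Summits.QuantumFields.BalabanUV.Beta.GAN24.DirichletExhaustionDeltaZ
import Literature.MathematicalPhysics.QuantumFieldTheory.Balaban1983to89.B5Kernel166Decay

/-!
# `BalabanUV.Beta.GAN24.DirichletExhaustionPeriodise` — binder row G-an2-4 / (CONV-C), part P2, PART 12 = skeleton node S3.a: THE TORUS
# MATRIX OF THE (1.66) FORM IS THE PERIODISATION OF THE ℤ^{d+1} KERNEL — `deltaPol M (L^k) p q = Σ'_m deltaZ L k p (q + M∘m)`
# (pv09-g6's `B6Cov2156Torus.deltaPol` ↔ PART 8's `deltaZ`), from b05-g9's bond dictionary `inner_eq` and pv17's Poisson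
# identity `torusKernel_descend_eq` BY NAME (unit b2b-balaban-gan24-p2, gen 1, v1)

HONEST FRAMING (cell contract, verbatim): «discharging `BetaPertH` makes Bałaban's UV stability UNCONDITIONAL — a real constructive-QFT
result; it is NOT the continuum limit and NOT the Clay problem.»  This is the dictionary step of skeleton node S3 ((2.153) on ℤ^{d+1} by TORUS
EXHAUSTION): with it, the torus lower bound `B6Cov2156Torus.lowerOnConstrainedT_of_represents` (k- and period-independent constant
`gamma2153`) can be pulled back to finitely supported constrained fields on ℤ^{d+1} once the wrap-around tails are sent to zero (S3.b/S3.c/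
S3.e, NOT here).  [folklore] bookkeeping (absolutely convergent re-arrangements); nothing printed is used as a hypothesis; NOT `BetaPertH`,
NOT continuum, NOT Clay.  «not in print; our proof attempt».

ABSOLUTE RULE (cell, verbatim): «No internally-minted statement may enter as a cited fact. Every hypothesis is either kernel-proved in this
package or a verbatim quotation of a PUBLISHED theorem with page reference. The manuscript(s) under audit are NOT citable for their own disputed
steps — they are the thing under adjudication; programme-internal (2001/route/tribunal) claims are never citable.»

WHAT IS PROVED (0 sorry): `summable_latticeKernel_translate`, `ksum_toT_eq_tsum` (`ksum M n μ ν a b (toT M z) = Σ'_m latticeKernel Gsym (z + M∘m)`),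
`re_combo_tsum`, `inner_eq_tsum_summand`, `summable_summand_translate`, **`deltaPol_eq_tsum_deltaZ`**.  NOT summit progress.
-/

namespace Summit.QuantumFields.BalabanUV.Beta.GAN24.DirichletExhaustionPeriodise

open Finset Real
open Literature.MathematicalPhysics.QuantumFieldTheory.Balaban1983to89
open B4ContourShift (latticeKernel latticeKernel_decay)
open B4TorusKernel (summable_of_decay)
open B4TorusKernel.MultiPeriod (translate translate_apply translate_injective torusKernel_descend_eq)
open B5Prop11Plancherel (Tor)
open B5Symbol166Strip (kappa166 kappa166_pos Gsym MG stripRegular_Gsym)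
open B6Lemma24Torus (pbox)
open B6LowerBound2153Torus (toT)
open B6Cov2156Torus (phiC wgt deltaPol)
open B5Kernel166Decay (ksum dirInd inner_eq inner_eq_zero_of_eq deltaPol_eq_sum ksum_toT_eq_torusKernel toT_sub)
open T4GaugeActionRatePair (kerRe kerFamily)
open B4Sect5Exhaustion (K)
open Summit.QuantumFields.BalabanUV.Beta.GAN24.DirichletExhaustionDeltaZ (dirI summand deltaZ)

noncomputable section

variable {d : ℕ} (M : Fin (d + 1) → ℕ) [hM : ∀ μ, NeZero (M μ)]

/-- `M_i ≥ 1`. -/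
theorem one_le_M (i : Fin (d + 1)) : 1 ≤ M i := Nat.one_le_iff_ne_zero.mpr (NeZero.ne (M i))

/-! ## §1 Summability of the periodised entry kernels and the Poisson dictionary for `ksum` -/

/-- The lattice kernel of an entry symbol is absolutely summable along every residue class `z + M∘ℤ^{d+1}`. -/
theorem summable_latticeKernel_translate (n : ℕ) [NeZero n] {μ ν : Fin (d + 1)} (hμν : μ ≠ ν) (a b : Fin (d + 1))
    (z : Fin (d + 1) → ℤ) : Summable fun m : Fin (d + 1) → ℤ => latticeKernel (fun p => Gsym n μ ν a b p) (translate M z m) := by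
  have hκ := kappa166_pos (d + 1)
  have hdec := fun x => latticeKernel_decay (stripRegular_Gsym (d := d) n hκ.le le_rfl hμν a b) hκ.le x
  exact (summable_of_decay _ hκ hdec).comp_injective (translate_injective (one_le_M M) z)

/-- **Poisson dictionary**: `ksum M n μ ν a b (toT M z) = Σ'_m latticeKernel (Gsym n μ ν a b) (z + M∘m)` (b05-g9 `ksum_toT_eq_torusKernel` + pv17
`MultiPeriod.torusKernel_descend_eq`). -/
theorem ksum_toT_eq_tsum (n : ℕ) [NeZero n] {μ ν : Fin (d + 1)} (hμν : μ ≠ ν) (a b : Fin (d + 1)) (z : Fin (d + 1) → ℤ) :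
    ksum M n μ ν a b (toT M z) = ∑' m : Fin (d + 1) → ℤ, latticeKernel (fun p => Gsym n μ ν a b p) (translate M z m) := by
  have hκ := kappa166_pos (d + 1)
  rw [ksum_toT_eq_torusKernel M n hκ le_rfl hμν a b z]
  exact torusKernel_descend_eq (stripRegular_Gsym (d := d) n hκ.le le_rfl hμν a b) hκ (one_le_M M) z

/-! ## §2 Real parts of four-term combinations of convergent series -/

/-- `(c₁Σf₁ − c₂Σf₂ − c₃Σf₃ + c₄Σf₄).re = Σ (c₁ Re f₁ − c₂ Re f₂ − c₃ Re f₃ + c₄ Re f₄)` for real `cᵢ` and summable complex families. -/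
theorem re_combo_tsum {ι : Type*} {f₁ f₂ f₃ f₄ : ι → ℂ} (h₁ : Summable f₁) (h₂ : Summable f₂) (h₃ : Summable f₃) (h₄ : Summable f₄)
    (c₁ c₂ c₃ c₄ : ℝ) :
    ((c₁ : ℂ) * ∑' i, f₁ i - (c₂ : ℂ) * ∑' i, f₂ i - (c₃ : ℂ) * ∑' i, f₃ i + (c₄ : ℂ) * ∑' i, f₄ i).re =
      ∑' i, (c₁ * (f₁ i).re - c₂ * (f₂ i).re - c₃ * (f₃ i).re + c₄ * (f₄ i).re) := by
  have hs : Summable fun i => (c₁ : ℂ) * f₁ i - (c₂ : ℂ) * f₂ i - (c₃ : ℂ) * f₃ i + (c₄ : ℂ) * f₄ i :=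
    (((h₁.mul_left _).sub (h₂.mul_left _)).sub (h₃.mul_left _)).add (h₄.mul_left _)
  have hcomb : (c₁ : ℂ) * ∑' i, f₁ i - (c₂ : ℂ) * ∑' i, f₂ i - (c₃ : ℂ) * ∑' i, f₃ i + (c₄ : ℂ) * ∑' i, f₄ i =
      ∑' i, ((c₁ : ℂ) * f₁ i - (c₂ : ℂ) * f₂ i - (c₃ : ℂ) * f₃ i + (c₄ : ℂ) * f₄ i) := by
    rw [← tsum_mul_left, ← tsum_mul_left, ← tsum_mul_left, ← tsum_mul_left, ← (h₁.mul_left _).tsum_sub (h₂.mul_left _),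
      ← Summable.tsum_sub ((h₁.mul_left _).sub (h₂.mul_left _)) (h₃.mul_left _), ← Summable.tsum_add _ (h₄.mul_left _)]
    exact ((h₁.mul_left _).sub (h₂.mul_left _)).sub (h₃.mul_left _)
  rw [hcomb, ← (Complex.hasSum_re hs.hasSum).tsum_eq]
  refine tsum_congr fun i => ?_
  simp only [Complex.add_re, Complex.sub_re, Complex.re_ofReal_mul]

/-! ## §3 One `(μ, ν)` block: b05-g9's `inner_eq` in periodised form -/

omit hM in
/-- The direction indicator of the torus dictionary is PART 8's `dirI`. -/
theorem dirInd_eq_dirI (κ : Fin (d + 1)) (p : B4.Idx (pbox M) (d + 1)) : dirInd M κ p = dirI κ p.2 := rfl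

omit hM in
/-- `x − (y + M∘(−m)) = (x − y) + M∘m`. -/
theorem sub_translate_neg (x y m : Fin (d + 1) → ℤ) : x - translate M y (-m) = translate M (x - y) m := by
  funext i; simp only [Pi.sub_apply, translate_apply, Pi.neg_apply]; ring

/-- For `μ ≠ ν`, the periodised `(μ,ν)`-summand family is summable. -/
theorem summable_summand_translate (L : ℕ) [NeZero L] (k : ℕ) {μ ν : Fin (d + 1)} (hμν : μ ≠ ν) (α β : Fin (d + 1))
    (z : Fin (d + 1) → ℤ) :
    Summable fun m : Fin (d + 1) → ℤ => summand (fun a b => kerFamily (d := d) L μ ν a b k) μ ν α β (translate M z m) := by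
  have hs : ∀ a b, Summable fun m : Fin (d + 1) → ℤ => kerFamily (d := d) L μ ν a b k (translate M z m) := by
    intro a b
    have h := (Complex.hasSum_re (summable_latticeKernel_translate M (L ^ k) hμν a b z).hasSum).summable
    exact h
  unfold summand
  exact ((((hs μ μ).mul_left _).sub ((hs μ ν).mul_left _)).sub ((hs ν μ).mul_left _)).add ((hs ν ν).mul_left _)

/-- **The `(μ,ν)` block of `deltaPol`, periodised**: for `μ ≠ ν`,
`Σ_t wgt·Re(conj φ(e_p) φ(e_q)) = Σ'_m summand (K^{(n)}_{μν;··}) μ ν α β ((x − y) + M∘m)` (b05-g9 `inner_eq` + §1 + §2). -/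
theorem inner_eq_tsum_summand (L : ℕ) [NeZero L] (k : ℕ) (p q : B4.Idx (pbox M) (d + 1)) {μ ν : Fin (d + 1)} (hμν : μ ≠ ν) :
    ∑ t : Tor M, wgt M (L ^ k) ((μ, ν), t) *
        ((starRingEnd ℂ) (phiC M (Pi.single p 1) μ ν t) * phiC M (Pi.single q 1) μ ν t).re =
      ∑' m : Fin (d + 1) → ℤ, summand (fun a b => kerFamily (d := d) L μ ν a b k) μ ν p.2 q.2
        (translate M ((p.1 : Fin (d + 1) → ℤ) - (q.1 : Fin (d + 1) → ℤ)) m) := by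
  set z : Fin (d + 1) → ℤ := (p.1 : Fin (d + 1) → ℤ) - (q.1 : Fin (d + 1) → ℤ) with hz
  rw [inner_eq, toT_sub, ← hz, ksum_toT_eq_tsum M (L ^ k) hμν μ μ z, ksum_toT_eq_tsum M (L ^ k) hμν μ ν z,
    ksum_toT_eq_tsum M (L ^ k) hμν ν μ z, ksum_toT_eq_tsum M (L ^ k) hμν ν ν z]
  simp only [dirInd_eq_dirI, ← Complex.ofReal_mul]
  rw [re_combo_tsum (summable_latticeKernel_translate M _ hμν μ μ z) (summable_latticeKernel_translate M _ hμν μ ν z)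
    (summable_latticeKernel_translate M _ hμν ν μ z) (summable_latticeKernel_translate M _ hμν ν ν z)]
  refine tsum_congr fun m => ?_
  simp only [summand, kerFamily, kerRe]

/-! ## §4 The torus matrix is the periodisation of the ℤ^{d+1} kernel -/

/-- **S3.a — `deltaPol M (L^k) p q = Σ'_m deltaZ L k (x, α) (y + M∘m, β)`** for all bonds `p = (x, α)`, `q = (y, β)` of the torus box:
pv09-g6's torus matrix of the (1.66) form is the periodisation of PART 8's infinite-lattice kernel. -/
theorem deltaPol_eq_tsum_deltaZ (L : ℕ) [NeZero L] (k : ℕ) (p q : B4.Idx (pbox M) (d + 1)) :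
    deltaPol M (L ^ k) p q =
      ∑' m : Fin (d + 1) → ℤ, deltaZ L k ((p.1 : Fin (d + 1) → ℤ), p.2) (translate M (q.1 : Fin (d + 1) → ℤ) m, q.2) := by
  set x : Fin (d + 1) → ℤ := (p.1 : Fin (d + 1) → ℤ) with hx
  set y : Fin (d + 1) → ℤ := (q.1 : Fin (d + 1) → ℤ) with hy
  -- reindex the right-hand side by `m ↦ −m` and unfold `deltaZ`
  have hre : (∑' m : Fin (d + 1) → ℤ, deltaZ L k (x, p.2) (translate M y m, q.2)) =
      ∑' m : Fin (d + 1) → ℤ, ∑ μ : Fin (d + 1), ∑ ν : Fin (d + 1),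
        if μ = ν then 0 else summand (fun a b => kerFamily (d := d) L μ ν a b k) μ ν p.2 q.2 (translate M (x - y) m) := by
    rw [← (Equiv.neg (Fin (d + 1) → ℤ)).tsum_eq]
    refine tsum_congr fun m => ?_
    simp only [Equiv.neg_apply, deltaZ, sub_translate_neg]
  rw [hre, deltaPol_eq_sum]
  -- pull the finite sums out of the series
  have hsum : ∀ μ ν : Fin (d + 1), Summable fun m : Fin (d + 1) → ℤ =>
      if μ = ν then (0 : ℝ) else summand (fun a b => kerFamily (d := d) L μ ν a b k) μ ν p.2 q.2 (translate M (x - y) m) := by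
    intro μ ν
    by_cases h : μ = ν
    · simp only [if_pos h]; exact summable_zero
    · simp only [if_neg h]; exact summable_summand_translate M L k h p.2 q.2 (x - y)
  rw [Summable.tsum_finsetSum (fun μ _ => summable_sum fun ν _ => hsum μ ν)]
  refine Finset.sum_congr rfl fun μ _ => ?_
  rw [Summable.tsum_finsetSum (fun ν _ => hsum μ ν)]
  refine Finset.sum_congr rfl fun ν _ => ?_
  by_cases h : μ = ν
  · subst h
    rw [inner_eq_zero_of_eq]
    simp
  · simp only [if_neg h]
    exact inner_eq_tsum_summand M L k p q h

end

end Summit.QuantumFields.BalabanUV.Beta.GAN24.DirichletExhaustionPeriodise
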